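import Mathlib
import Literature.NumberTheory.LFunctions.Zhang2022.SkeletonPartTwo
import Literature.NumberTheory.LFunctions.Zhang2022.Section14MeanSquareMajorant
import Literature.NumberTheory.LFunctions.Zhang2022.TypedSection15A
import Literature.NumberTheory.LFunctions.Zhang2022.TypedSection15B
import HarnessLib

/-!
# Zhang (2022), typed manuscript — Appendix A, part 1: the printed proof of Lemma 8.3
# ((A.1)–(A.3), Cases 1–3) and the prerequisites (A.4)–(A.5) for Lemmas 15.2–15.3

Topic `Literature/NumberTheory/LFunctions/Zhang2022` (Landau–Siegel audit tree; verdict-neutral).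
Y. Zhang, *Discrete mean estimates and the Landau–Siegel zero*, arXiv:2211.02515v1 (2022)
[Zhang2022LandauSiegel], Appendix A, PDF pp. 101–103, tex L4969–L5109 (campaign DAG nodes
`Z22:§A.u001 … Z22:§A.u020`, `Z22:(A.1) … Z22:(A.5)`, `Z22:Lem8.3.pf`). **An unrefereed manuscript
under adjudication: every `def … : Prop` below is a CLAIM OF THE MANUSCRIPT, STATED NOT ASSERTED,
transcribed as printed (visible misprints are typed as printed and FLAGGED in the docstring).**
Nothing here asserts or denies Theorems 1–2. typed ≠ discharged.

What is typed. The displayed steps of "Proof of Lemma 8.3" (App. A pp. 101–103): the shorthand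
`u = q⁻¹, v = χ(q)` (u001); `λ(km,s) = λ(k,s)λ̃(m,k;s)` (u002) with `λ̃` (u003); the Euler product
`𝒰_j(d,h;s) = λ(dh,1−β_j)∏_q 𝔱_j(d,1,s;q)` (u004) with the local factor `𝔱_j(d,h,s;q)` (u005); the
generic-`q` estimate (u006), the truncation to `q < D` (u007), `λ(dh,1−β_j) = φ(dh)²/(dh₁)² + O(α₁)`
(u008); the targets (A.1)–(A.3) under the standing conditions (u009); Case 1 (u010–u015), Case 2
(u016–u017), Case 3 (u018–u019); then (A.4), the identity `κ̃₁(q^{r−1},dq) = κ₁(q^{r−1})` (u020)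
and (A.5). The proof block `Z22:Lem8.3.pf` is the implication `DedLem83` (inputs ⇒
`Skeleton.Lemma83`), and "yields (A.k)" are `DedA1/DedA2/DedA3`; all refine the skeleton leaf
`Skeleton.Lemma83 c′` (whose PROOF is this appendix; the STATEMENT is §8's node).

Objects. App. A's `ξ_j(m;d,h)` is the INNER SUM of §7's `ξ₀ⱼ(m;d,h)` (no factor `λ̃₀ⱼ(m,dh)`):
`xiA`, with `Skeleton.xiZero = Skeleton.lamTildeZero · xiA` by `rfl` (`xiZero_eq`). `𝒰_j(d,h;s)`
for `σ > 1` is `calU` = the product in `Skeleton.Lemma83`; in the region `σ > 9/10` the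
manuscript's `𝒰_j` is ITS ANALYTIC CONTINUATION, typed (as in `Skeleton.Lemma83`) by quantifying
over functions `U` analytic on `{σ > 9/10}` that agree with `calU` on `σ > 1`. Sums `Σ_r` over
`r ≥ 1` are `tsum`s over `r + 1`; `∏_q` over all primes is a `HasProd` over `Nat.Primes`; `∏_{q<D}`
is over `Nat.primesBelow D`. `α₁` (undefined in v1) is read `α𝓛` as in `Skeleton.Lemma151`;
`τ₂(n)` = number of divisors. Standing frame of every estimate: `Skeleton.ForAllLarge`, Assumption
(A), `1 ≤ j ≤ 3`, and Lemma 8.3's hypothesis `dh < PT⁻²` (`h` = the `r` of §8).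

FLAGS OF RECORD (typed as printed): (F1) `h₁` (in u007, u008, (A.1)–(A.3), Case 3) is undefined in
Appendix A — read `h`; (F2) u004 prints `𝔱_j(d,1,s;q)` (the `h`-slot carries `1`) and a prefactor
`λ(dh,1−β_j)` which, with §7's `ξ₀ⱼ = λ̃₀ⱼ·(inner sum)` (`Skeleton.xiZero`) and §8's definition of
`𝒰_j` (`Skeleton.Lemma83`), is NOT produced by the Euler product (the product of Lemma 8.3's series
is `∏_q 𝔱_j(d,h,s;q)` alone; compare the separate weight `λ₀ⱼ(dr)` in `S_j` of Prop. 7.1) — u004,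
u007, u008 are typed with the printed prefactor, and `StepA_u004_read` records the prefactor-free
reading; (F3) u006 prints `ξ_j(q^r;d,h)` with `O(q⁻¹)` for unrestricted `q, r` — the next sentence
uses it at `r = 1`, `(q,dh) = 1` (`StepA_u006_used`); (F4) u011 prints exponents `q^{μ₁β₁+μ₂β₂+μ₃β₃}`
(the generating function gives `q^{−(…)}`; moduli are `1` either way); (F5) the term-wise error
`O(αr log q/q)` printed in u012, u016, u018 (for `r = 1`, u011 gives `κ(q) = 2 + O(α log q)`, no
`q⁻¹`); (F6) u018 prints `κ(q^{r−1})q/(q−1)` where u010's pattern gives `q^{1−β_j}`; (F7) u010's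
"because" prints `κ̃(q^{r−1};dq,·)` (context `dhq`) and u006/L4982 print `λ̃(q;d,1−β_j)`,
`λ̃(m,h,d;1−β_j)` for `λ̃(·,dh;1−β_j)`.

TODO-merge stubs (§15 objects provided by the campaign files `TypedSection15A/B`; identical
meaning, to be re-pointed when those land): `kappa1` (= the tree's `MeanSquareMajorant.kappa₁`),
`kappaTilde1` (15.9), `lam1` (15.10), `xiOne` (15.13), `lamTilde1`, `frakm1` (§15 p. 84). MERGED
(revision 2, section `Merge` at the end): the providers have landed and every stub is provably (`rfl`)
the provider's decl — `Typed.Section15A.kappa1/kappaTilde1/lam1`, `Typed.Section15B.xi1/lamTilde1/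
calM1Series`, and `factorA4 = Typed.Section15B.calM1Factor`.

## References

* Y. Zhang, arXiv:2211.02515v1 (2022), Appendix A pp. 101–103, (A.1)–(A.5); §7 pp. 32–34 (κ̃, λ,
  ξ₀ⱼ, κ); §8 Lemma 8.3 p. 46; §15 pp. 81–84 ((15.9), (15.10), (15.13), 𝔪₁). [cite: Zhang2022LandauSiegel, App. A]
-/

noncomputable section

open Complex Real ComplexConjugate

namespace Literature.NumberTheory.LFunctions.Zhang2022.Typed.AppendixA1

open Literature.NumberTheory.LFunctions.Zhang2022
open Literature.NumberTheory.LFunctions.Zhang2022.Skeleton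

/-! ## Objects of Appendix A (u001, u003, u005) -/

section Objects

variable (c' : ℝ)

/-- **`u = q⁻¹`** (Z22:§A.u001). [cite: Zhang2022LandauSiegel, App. A p.101, tex L4969] -/
def uA (q : ℕ) : ℂ := (q : ℂ)⁻¹

/-- **`v = χ(q)`** (Z22:§A.u001). [cite: Zhang2022LandauSiegel, App. A p.101, tex L4969] -/
def vA {D : ℕ} (χ : DirichletCharacter ℂ D) (q : ℕ) : ℂ := χ (q : ZMod D)

/-- **`λ̃(m,k;s) = ∏_{q∣m,(q,k)=1} (1−q^{−s−β₁})(1−q^{−s−β₂})(1−q^{−s−β₃})/(1−q^{−s})`** (Z22:§A.u003;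
the factors of `Skeleton.lam`). [cite: Zhang2022LandauSiegel, App. A p.101, tex L4980] -/
def lamTilde (D : ℕ) (m k : ℕ) (s : ℂ) : ℂ :=
  ∏ q ∈ m.primeFactors.filter (fun q => Nat.Coprime q k),
    (1 - (q : ℂ) ^ (-(s + beta1 c' D))) * (1 - (q : ℂ) ^ (-(s + beta2 c' D))) *
      (1 - (q : ℂ) ^ (-(s + beta3 c' D))) / (1 - (q : ℂ) ^ (-s))

/-- **App. A's `ξ_j(m;d,h)`** = the inner sum `Σ_{m=d₁k,(k,h)=1} κ̃(d₁;dhk,1−β_j)μ(k)k^{1−β_j}/φ(k)`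
of §7's `ξ₀ⱼ(m;d,h)` (p.101 writes `λ̃(m,h,d;1−β_j)ξ_j(m;d,h)`, flag F7: the `λ̃₀ⱼ` factor is kept
separate). [cite: Zhang2022LandauSiegel, App. A p.101, tex L4982; §7 p.33] -/
def xiA (D : ℕ) (j m d h : ℕ) : ℂ :=
  ∑ k ∈ m.divisors.filter (fun k => Nat.Coprime k h),
    kappaTildeZero c' D j (m / k) (d * h * k) * (ArithmeticFunction.moebius k : ℂ) *
      (k : ℂ) ^ (1 - betaJ c' D j) / (Nat.totient k : ℂ)

/-- §7's `ξ₀ⱼ(m;d,h)` (`Skeleton.xiZero`) is `λ̃₀ⱼ(m,dh)·ξ_j(m;d,h)` with App. A's `ξ_j`, by `rfl`.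
[cite: Zhang2022LandauSiegel, §7 p.33; App. A p.101] -/
theorem xiZero_eq (D : ℕ) (j m d h : ℕ) :
    xiZero c' D j m d h = lamTildeZero c' D j m (d * h) * xiA c' D j m d h := rfl

/-- The first factor of `𝔱_j`: `(1−χ(q)q^{−s−β_{j+1}})(1−χ(q)q^{−s−β_{j+2}})/(1−χ(q)q^{−s})`
(Z22:§A.u005, u015). [cite: Zhang2022LandauSiegel, App. A p.101, tex L4988] -/
def pref {D : ℕ} (χ : DirichletCharacter ℂ D) (j : ℕ) (s : ℂ) (q : ℕ) : ℂ :=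
  (1 - χ (q : ZMod D) * (q : ℂ) ^ (-(s + betaJ c' D (j + 1)))) *
      (1 - χ (q : ZMod D) * (q : ℂ) ^ (-(s + betaJ c' D (j + 2)))) /
    (1 - χ (q : ZMod D) * (q : ℂ) ^ (-s))

/-- **`Σ_r χ(q^r)ξ_j(q^r;d,h)/q^{rs}`** (`r ≥ 1`, inside `𝔱_j`; Z22:§A.u005, u013, u017, u019), as a
series over `r + 1`. [cite: Zhang2022LandauSiegel, App. A p.101, tex L4988] -/
def xiPowSum {D : ℕ} (χ : DirichletCharacter ℂ D) (j d h : ℕ) (s : ℂ) (q : ℕ) : ℂ :=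
  ∑' r : ℕ, χ ((q ^ (r + 1) : ℕ) : ZMod D) * xiA c' D j (q ^ (r + 1)) d h /
    (q : ℂ) ^ (((r + 1 : ℕ) : ℂ) * s)

/-- **`𝔱_j(d,h,s;q) = pref · (1 + λ̃(q,dh;1−β_j) Σ_r χ(q^r)ξ_j(q^r;d,h)/q^{rs})`** (Z22:§A.u005).
[cite: Zhang2022LandauSiegel, App. A p.101, tex L4988] -/
def frakt {D : ℕ} (χ : DirichletCharacter ℂ D) (j d h : ℕ) (s : ℂ) (q : ℕ) : ℂ :=
  pref c' χ j s q * (1 + lamTilde c' D q (d * h) (1 - betaJ c' D j) * xiPowSum c' χ j d h s q)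

/-- **`𝒰_j(d,h;s)` for `σ > 1`** (§8 Lemma 8.3): `L(s,χ)/(L(s+β_{j+1},χ)L(s+β_{j+2},χ)) ·
Σ_m χ(m)ξ₀ⱼ(m;d,h)m^{−s}` — the product in `Skeleton.Lemma83` (`Skeleton.xiSeries`).
[cite: Zhang2022LandauSiegel, §8 Lemma 8.3 p.46; App. A p.101] -/
def calU {D : ℕ} [NeZero D] (χ : DirichletCharacter ℂ D) (j d h : ℕ) (s : ℂ) : ℂ :=
  χ.LFunction s / (χ.LFunction (s + betaJ c' D (j + 1)) * χ.LFunction (s + betaJ c' D (j + 2))) *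
    xiSeries c' χ j d h s

/-- The standing conditions **"`|s−1| < 5α`, `q < D` and `(q,D) = 1`"** (Z22:§A.u009, "henceforth
assumed"). [cite: Zhang2022LandauSiegel, App. A p.102, tex L5019] -/
def CondA9 (D : ℕ) (s : ℂ) (q : ℕ) : Prop := ‖s - 1‖ < 5 * alpha D ∧ q < D ∧ Nat.Coprime q D

/-! ### TODO-merge stubs: §15 objects used by (A.4), (A.5) -/

/-- STUB (TODO-merge `Typed.Section15A`): **`κ₁`**, `Σ κ₁(m)m^{−s} = ζ(s+β₁)ζ(s+β₂)/ζ(s)` — the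
tree's `MeanSquareMajorant.kappa₁` at `b₁, b₂`. [cite: Zhang2022LandauSiegel, §15 p.81, tex L4078] -/
def kappa1 (D : ℕ) : ArithmeticFunction ℂ := MeanSquareMajorant.kappa₁ (b1 c' D) (b2 c' D)

open scoped Classical in
/-- STUB (TODO-merge `Typed.Section15A`): **`κ̃₁(d₁;r,s) = Σ_{h∈𝔫(d₁),(h,r)=1} κ₁(d₁h)χ(h)h^{−s}`**
(15.9), a series. [cite: Zhang2022LandauSiegel, §15 (15.9) p.82, tex L4117] -/
def kappaTilde1 {D : ℕ} (χ : DirichletCharacter ℂ D) (d r : ℕ) (s : ℂ) : ℂ :=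
  ∑' h : ℕ, if h ∈ nset d ∧ Nat.Coprime h r then
    kappa1 c' D (d * h) * χ (h : ZMod D) / (h : ℂ) ^ s else 0

/-- STUB (TODO-merge `Typed.Section15A`): **`λ₁(n,s) = ∏_{q∣n}(1−χ(q)q^{−s−β₁})(1−χ(q)q^{−s−β₂})/
(1−χ(q)q^{−s})`** (15.10). [cite: Zhang2022LandauSiegel, §15 (15.10) p.82, tex L4121] -/
def lam1 {D : ℕ} (χ : DirichletCharacter ℂ D) (n : ℕ) (s : ℂ) : ℂ :=
  ∏ q ∈ n.primeFactors, (1 - χ (q : ZMod D) * (q : ℂ) ^ (-(s + beta1 c' D))) *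
    (1 - χ (q : ZMod D) * (q : ℂ) ^ (-(s + beta2 c' D))) / (1 - χ (q : ZMod D) * (q : ℂ) ^ (-s))

/-- STUB (TODO-merge `Typed.Section15B`): **`ξ₁(n;d,l) = Σ_{n=mk,(k,l)=1} μχ(k)k/φ(k)·κ̃₁(m;dk)`**
(15.13), `κ̃₁(m;dk) = κ̃₁(m;dk,1)`. [cite: Zhang2022LandauSiegel, §15 (15.13) p.83, tex L4168] -/
def xiOne {D : ℕ} (χ : DirichletCharacter ℂ D) (n d l : ℕ) : ℂ :=
  ∑ k ∈ n.divisors.filter (fun k => Nat.Coprime k l),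
    (ArithmeticFunction.moebius k : ℂ) * χ (k : ZMod D) * (k : ℂ) / (Nat.totient k : ℂ) *
      kappaTilde1 c' χ (n / k) (d * k) 1

/-- STUB (TODO-merge `Typed.Section15B`): **`λ̃₁(n,d) = ∏_{q∣n,(q,d)=1} λ₁(q)`**, `λ₁(q) = λ₁(q,1)`
(§15 p.83). [cite: Zhang2022LandauSiegel, §15 p.83, tex L4176] -/
def lamTilde1 {D : ℕ} (χ : DirichletCharacter ℂ D) (n d : ℕ) : ℂ :=
  ∏ q ∈ n.primeFactors.filter (fun q => Nat.Coprime q d), lam1 c' χ q 1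

/-- STUB (TODO-merge `Typed.Section15B`): **`𝔪₁(d,l;s) = ζ(s)L(s,χ)/(ζ(s+β₁)ζ(s+β₂)) ·
Σ_n λ̃₁(n,d)ξ₁(n;d,l)n^{−s}`** (§15 p.84, the `σ > 1` definition; "is analytic … for `σ > 9/10`").
[cite: Zhang2022LandauSiegel, §15 p.84, tex L4225] -/
def frakm1 {D : ℕ} [NeZero D] (χ : DirichletCharacter ℂ D) (d l : ℕ) (s : ℂ) : ℂ :=
  riemannZeta s * χ.LFunction s / (riemannZeta (s + beta1 c' D) * riemannZeta (s + beta2 c' D)) *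
    (∑' n : ℕ, lamTilde1 c' χ n d * xiOne c' χ n d l / (n : ℂ) ^ s)

/-- The `q`-factor of (A.4): `(1−q^{−s−β₁})(1−q^{−s−β₂})/((1−q^{−s})(1−χ(q)q^{−s})) ·
(1 + λ̃₁(q,d)Σ_r ξ₁(q^r;d,l)/q^{rs})` (`r ≥ 1`). [cite: Zhang2022LandauSiegel, App. A (A.4) p.103, tex L5099] -/
def factorA4 {D : ℕ} (χ : DirichletCharacter ℂ D) (d l : ℕ) (s : ℂ) (q : ℕ) : ℂ :=
  (1 - (q : ℂ) ^ (-(s + beta1 c' D))) * (1 - (q : ℂ) ^ (-(s + beta2 c' D))) /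
      ((1 - (q : ℂ) ^ (-s)) * (1 - χ (q : ZMod D) * (q : ℂ) ^ (-s))) *
    (1 + lamTilde1 c' χ q d *
      (∑' r : ℕ, xiOne c' χ (q ^ (r + 1)) d l / (q : ℂ) ^ (((r + 1 : ℕ) : ℂ) * s)))

end Objects

/-! ## The displayed claims of the proof of Lemma 8.3 -/

section Claims

variable (c' : ℝ)

/-- **Z22:§A.u002**: "`λ(km,s) = λ(k,s)λ̃(m,k;s)`" (an identity of finite products; `k, m ≥ 1`).
CLAIM. [cite: Zhang2022LandauSiegel, App. A p.101, tex L4976] -/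
def StepA_u002 : Prop :=
  ∀ D k m : ℕ, 1 ≤ k → 1 ≤ m → ∀ s : ℂ, lam c' D (k * m) s = lam c' D k s * lamTilde c' D m k s

/-- **Z22:§A.u004 (lead-in, tex L4982)**: "`λ̃(q^r,k;s) = λ̃(q,k;s)` for any `r`" (`r ≥ 1`, `q` prime).
CLAIM. [cite: Zhang2022LandauSiegel, App. A p.101, tex L4982] -/
def StepA_u004_pow : Prop :=
  ∀ D q r k : ℕ, q.Prime → 1 ≤ r → ∀ s : ℂ, lamTilde c' D (q ^ r) k s = lamTilde c' D q k s

/-- **Z22:§A.u004** AS PRINTED: "Thus, for `σ > 1`, `𝒰_j(d,h;s) = λ(dh,1−β_j)∏_q 𝔱_j(d,1,s;q)`"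
(flag F2: printed `h`-slot `1` and prefactor `λ(dh,1−β_j)`; see `StepA_u004_read`). The product over
all primes is a `HasProd`. CLAIM. [cite: Zhang2022LandauSiegel, App. A p.101, tex L4984] -/
def StepA_u004 : Prop :=
  ForAllLarge fun D _ χ => AssumptionA D χ → ∀ j ∈ ({1, 2, 3} : Finset ℕ), ∀ d h : ℕ,
    1 ≤ d → 1 ≤ h → ((d * h : ℕ) : ℝ) < bigP D / bigT D ^ 2 → ∀ s : ℂ, 1 < s.re →
      ∃ T : ℂ, HasProd (fun q : Nat.Primes => frakt c' χ j d 1 s (q : ℕ)) T ∧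
        calU c' χ j d h s = lam c' D (d * h) (1 - betaJ c' D j) * T

/-- Z22:§A.u004, PREFACTOR-FREE READING (NOT the printed display; recorded for the dischargers, flag
F2): for `σ > 1`, `𝒰_j(d,h;s) = ∏_q 𝔱_j(d,h,s;q)` — what multiplicativity of `λ̃₀ⱼ(m,dh)ξ_j(m;d,h)`
and `λ̃(q^r,·) = λ̃(q,·)` give for §8's `𝒰_j`. CLAIM (reading). [cite: Zhang2022LandauSiegel, App. A p.101, tex L4982–4986] -/
def StepA_u004_read : Prop :=
  ForAllLarge fun D _ χ => AssumptionA D χ → ∀ j ∈ ({1, 2, 3} : Finset ℕ), ∀ d h : ℕ,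
    1 ≤ d → 1 ≤ h → ((d * h : ℕ) : ℝ) < bigP D / bigT D ^ 2 → ∀ s : ℂ, 1 < s.re →
      HasProd (fun q : Nat.Primes => frakt c' χ j d h s (q : ℕ)) (calU c' χ j d h s)

/-- **Z22:§A.u006** AS PRINTED (flag F3): "`λ̃(q;d,1−β_j)χ(q)ξ_j(q^r;d,h) = χ(q)(κ(q) − q^{−β_j})
+ O(q⁻¹) = χ(q)(q^{−β_{j+1}} + q^{−β_{j+2}} − 1) + O(q⁻¹)`" (`λ̃(q;d,·)` read `λ̃(q,dh;·)`, F7), for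
all primes `q` and `r ≥ 1`, implied constant absolute. CLAIM. [cite: Zhang2022LandauSiegel, App. A p.101, tex L4993] -/
def StepA_u006 : Prop :=
  ∃ C : ℝ, ForAllLarge fun D _ χ => AssumptionA D χ → ∀ j ∈ ({1, 2, 3} : Finset ℕ), ∀ d h : ℕ,
    1 ≤ d → 1 ≤ h → ((d * h : ℕ) : ℝ) < bigP D / bigT D ^ 2 → ∀ q r : ℕ, q.Prime → 1 ≤ r →
      ‖lamTilde c' D q (d * h) (1 - betaJ c' D j) * χ (q : ZMod D) * xiA c' D j (q ^ r) d h -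
          χ (q : ZMod D) * (kappaZ c' D q - (q : ℂ) ^ (-betaJ c' D j))‖ ≤ C / q ∧
      ‖lamTilde c' D q (d * h) (1 - betaJ c' D j) * χ (q : ZMod D) * xiA c' D j (q ^ r) d h -
          χ (q : ZMod D) * ((q : ℂ) ^ (-betaJ c' D (j + 1)) + (q : ℂ) ^ (-betaJ c' D (j + 2)) - 1)‖
        ≤ C / q

/-- Z22:§A.u006 AS USED by the next sentence (flag F3; `r = 1`, `(q,dh) = 1`, all primes `q`):
`λ̃(q,dh;1−β_j)χ(q)ξ_j(q;d,h) = χ(q)(q^{−β_{j+1}} + q^{−β_{j+2}} − 1) + O(q⁻¹)`. CLAIM (instance).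
[cite: Zhang2022LandauSiegel, App. A p.101, tex L4993] -/
def StepA_u006_used : Prop :=
  ∃ C : ℝ, ForAllLarge fun D _ χ => AssumptionA D χ → ∀ j ∈ ({1, 2, 3} : Finset ℕ), ∀ d h : ℕ,
    1 ≤ d → 1 ≤ h → ((d * h : ℕ) : ℝ) < bigP D / bigT D ^ 2 → ∀ q : ℕ, q.Prime →
      Nat.Coprime q (d * h) →
      ‖lamTilde c' D q (d * h) (1 - betaJ c' D j) * χ (q : ZMod D) * xiA c' D j q d h -
          χ (q : ZMod D) * ((q : ℂ) ^ (-betaJ c' D (j + 1)) + (q : ℂ) ^ (-betaJ c' D (j + 2)) - 1)‖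
        ≤ C / q

/-- **Z22:§A.u007 (text, tex L4999)**: "we have `𝔱_j(d,h,s;q) = 1 + O(q^{−9/5})` for `σ > 9/10`"
(typed for `(q,dh) = 1`, the generic case the convergence argument needs; the text states no
condition on `q` — for `q ∣ dh` the factor is `1 + O(q^{−σ})`, cf. §15 p.84 tex L4219–4222).
CLAIM. [cite: Zhang2022LandauSiegel, App. A p.101, tex L4999] -/
def StepA_u007_local : Prop :=
  ∃ C : ℝ, ForAllLarge fun D _ χ => AssumptionA D χ → ∀ j ∈ ({1, 2, 3} : Finset ℕ), ∀ d h : ℕ,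
    1 ≤ d → 1 ≤ h → ((d * h : ℕ) : ℝ) < bigP D / bigT D ^ 2 → ∀ q : ℕ, q.Prime →
      Nat.Coprime q (d * h) → ∀ s : ℂ, 9 / 10 < s.re →
        ‖frakt c' χ j d h s q - 1‖ ≤ C * (q : ℝ) ^ (-(9 / 5 : ℝ))

/-- **Z22:§A.u007 (text, tex L4999)**: "so `𝒰_{jμ}(d,s)` [sic: `𝒰_j(d,h;s)`] is analytic in this
region" — `𝒰_j` continues analytically from `σ > 1` to `σ > 9/10` (the first clause of Lemma 8.3).
CLAIM. [cite: Zhang2022LandauSiegel, App. A p.101, tex L4999] -/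
def StepA_u007_analytic : Prop :=
  ForAllLarge fun D _ χ => AssumptionA D χ → ∀ j ∈ ({1, 2, 3} : Finset ℕ), ∀ d h : ℕ,
    1 ≤ d → 1 ≤ h → ((d * h : ℕ) : ℝ) < bigP D / bigT D ^ 2 →
      ∃ U : ℂ → ℂ, DifferentiableOn ℂ U {s : ℂ | 9 / 10 < s.re} ∧
        ∀ s : ℂ, 1 < s.re → U s = calU c' χ j d h s

/-- **Z22:§A.u007** AS PRINTED (flags F1, F2): "and `𝒰_j(d,h;s) = λ(dh,1−β_j)∏_{q<D} 𝔱_j(d,h₁,s;q)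
+ O(D^{−c})`" in the region `σ > 9/10` (`𝒰_j` = its analytic continuation `U`; `h₁` read `h`; `c`
an absolute positive constant). CLAIM. [cite: Zhang2022LandauSiegel, App. A p.101, tex L5000] -/
def StepA_u007 : Prop :=
  ∃ c : ℝ, 0 < c ∧ ∃ C : ℝ, ForAllLarge fun D _ χ => AssumptionA D χ →
    ∀ j ∈ ({1, 2, 3} : Finset ℕ), ∀ d h : ℕ, 1 ≤ d → 1 ≤ h →
      ((d * h : ℕ) : ℝ) < bigP D / bigT D ^ 2 → ∀ U : ℂ → ℂ,
        DifferentiableOn ℂ U {s : ℂ | 9 / 10 < s.re} → (∀ s : ℂ, 1 < s.re → U s = calU c' χ j d h s) →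
          ∀ s : ℂ, 9 / 10 < s.re →
            ‖U s - lam c' D (d * h) (1 - betaJ c' D j) *
                (∏ q ∈ Nat.primesBelow D, frakt c' χ j d h s q)‖ ≤ C * (D : ℝ) ^ (-c)

/-- Z22:§A.u007, PREFACTOR-FREE READING (NOT the printed display; flags F1, F2; companion of
`StepA_u004_read`): in the region `σ > 9/10`, `𝒰_j(d,h;s) = ∏_{q<D} 𝔱_j(d,h,s;q) + O(D^{−c})`.
CLAIM (reading). [cite: Zhang2022LandauSiegel, App. A p.101, tex L5000] -/
def StepA_u007_read : Prop :=
  ∃ c : ℝ, 0 < c ∧ ∃ C : ℝ, ForAllLarge fun D _ χ => AssumptionA D χ →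
    ∀ j ∈ ({1, 2, 3} : Finset ℕ), ∀ d h : ℕ, 1 ≤ d → 1 ≤ h →
      ((d * h : ℕ) : ℝ) < bigP D / bigT D ^ 2 → ∀ U : ℂ → ℂ,
        DifferentiableOn ℂ U {s : ℂ | 9 / 10 < s.re} → (∀ s : ℂ, 1 < s.re → U s = calU c' χ j d h s) →
          ∀ s : ℂ, 9 / 10 < s.re →
            ‖U s - ∏ q ∈ Nat.primesBelow D, frakt c' χ j d h s q‖ ≤ C * (D : ℝ) ^ (-c)

/-- **Z22:§A.u008** AS PRINTED (flag F1: `(dh₁)²` read `(dh)²`; `α₁` read `α𝓛`): "`λ(dh,1−β_j) =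
φ(dh)²/(dh₁)² + O(α₁)`". CLAIM. [cite: Zhang2022LandauSiegel, App. A p.101, tex L5004] -/
def StepA_u008 : Prop :=
  ∃ C : ℝ, ForAllLarge fun D _ χ => AssumptionA D χ → ∀ j ∈ ({1, 2, 3} : Finset ℕ), ∀ d h : ℕ,
    1 ≤ d → 1 ≤ h → ((d * h : ℕ) : ℝ) < bigP D / bigT D ^ 2 →
      ‖lam c' D (d * h) (1 - betaJ c' D j) -
          ((Nat.totient (d * h) : ℂ) ^ 2 / (((d * h : ℕ) : ℂ) ^ 2))‖ ≤ C * (alpha D * ell D)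

/-- **Z22:§A.u008 (text, tex L5006)**: "and `𝔱_j(d,h,s;q) = 1` if `q ∣ D`" (then `χ(q) = 0`).
CLAIM. [cite: Zhang2022LandauSiegel, App. A p.101, tex L5006] -/
def StepA_u008_dvd : Prop :=
  ∀ (D : ℕ) [NeZero D] (χ : DirichletCharacter ℂ D), ∀ j d h q : ℕ, q.Prime → q ∣ D → ∀ s : ℂ,
    frakt c' χ j d h s q = 1

/-- **(A.1)** (Z22:(A.1); flag F1: `(q,dh₁) = 1` read `(q,dh) = 1`): "`𝔱_j(d,h,s;q) = 1 + O(α log q/q)`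
if `(q,dh) = 1`", provided `|s−1| < 5α`, `q < D`, `(q,D) = 1` (u009). CLAIM.
[cite: Zhang2022LandauSiegel, App. A (A.1) p.101, tex L5008] -/
def EqA_1 : Prop :=
  ∃ C : ℝ, ForAllLarge fun D _ χ => AssumptionA D χ → ∀ j ∈ ({1, 2, 3} : Finset ℕ), ∀ d h : ℕ,
    1 ≤ d → 1 ≤ h → ((d * h : ℕ) : ℝ) < bigP D / bigT D ^ 2 → ∀ q : ℕ, q.Prime → ∀ s : ℂ,
      CondA9 D s q → Nat.Coprime q (d * h) →
        ‖frakt c' χ j d h s q - 1‖ ≤ C * (alpha D * Real.log q / q)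

/-- **(A.2)** (Z22:(A.2); flag F1: `q ∣ h₁` read `q ∣ h`): "`𝔱_j(d,h,s;q) = 1/(1−vu) + O(α log q/q)`
if `q ∣ h`", under u009. CLAIM. [cite: Zhang2022LandauSiegel, App. A (A.2) p.102, tex L5011] -/
def EqA_2 : Prop :=
  ∃ C : ℝ, ForAllLarge fun D _ χ => AssumptionA D χ → ∀ j ∈ ({1, 2, 3} : Finset ℕ), ∀ d h : ℕ,
    1 ≤ d → 1 ≤ h → ((d * h : ℕ) : ℝ) < bigP D / bigT D ^ 2 → ∀ q : ℕ, q.Prime → ∀ s : ℂ,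
      CondA9 D s q → q ∣ h →
        ‖frakt c' χ j d h s q - 1 / (1 - vA χ q * uA q)‖ ≤ C * (alpha D * Real.log q / q)

/-- **(A.3)** (Z22:(A.3); flag F1: `(q,h₁) = 1` read `(q,h) = 1`): "`𝔱_j(d,h,s;q) =
(1−u−vu)/((1−vu)(1−u)) + O(α log q/q)` if `q ∣ d`, `(q,h) = 1`", under u009. CLAIM.
[cite: Zhang2022LandauSiegel, App. A (A.3) p.102, tex L5015] -/
def EqA_3 : Prop :=
  ∃ C : ℝ, ForAllLarge fun D _ χ => AssumptionA D χ → ∀ j ∈ ({1, 2, 3} : Finset ℕ), ∀ d h : ℕ,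
    1 ≤ d → 1 ≤ h → ((d * h : ℕ) : ℝ) < bigP D / bigT D ^ 2 → ∀ q : ℕ, q.Prime → ∀ s : ℂ,
      CondA9 D s q → q ∣ d → Nat.Coprime q h →
        ‖frakt c' χ j d h s q - (1 - uA q - vA χ q * uA q) / ((1 - vA χ q * uA q) * (1 - uA q))‖
          ≤ C * (alpha D * Real.log q / q)

/-! ### Case 1: `(q,dh) = 1` (u010–u015) -/

/-- **Z22:§A.u010** (Case 1): "`ξ_j(q^r,dh) = κ̃(q^r;dh,1−β_j) − κ(q^{r−1})q^{1−β_j}/(q−1)`"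
(`r ≥ 1`; exact). CLAIM. [cite: Zhang2022LandauSiegel, App. A p.102, tex L5029] -/
def StepA_u010 : Prop :=
  ∀ (D : ℕ) (j d h q r : ℕ), 1 ≤ d → 1 ≤ h → q.Prime → q < D → Nat.Coprime q D →
    Nat.Coprime q (d * h) → 1 ≤ r →
      xiA c' D j (q ^ r) d h = kappaTilde c' D (q ^ r) (d * h) (1 - betaJ c' D j) -
        kappaZ c' D (q ^ (r - 1)) * (q : ℂ) ^ (1 - betaJ c' D j) / ((q : ℂ) - 1)

/-- **Z22:§A.u010 (text, tex L5032)** AS PRINTED (flag F7: `dq`, context `dhq`): "because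
`κ̃(q^{r−1};dq,1−β_j) = κ(q^{r−1})`" (any `r`; here with exponent `r`). CLAIM.
[cite: Zhang2022LandauSiegel, App. A p.102, tex L5032] -/
def StepA_u010_because : Prop :=
  ∀ (D : ℕ) (j d q r : ℕ), 1 ≤ d → q.Prime →
    kappaTilde c' D (q ^ r) (d * q) (1 - betaJ c' D j) = kappaZ c' D (q ^ r)

/-- **Z22:§A.u011, identity** AS PRINTED (flag F4, positive exponents): "`κ(q^r) =
Σ_{μ₁+μ₂+μ₃=r} q^{μ₁β₁+μ₂β₂+μ₃β₃} − Σ_{μ₁+μ₂+μ₃=r−1} q^{μ₁β₁+μ₂β₂+μ₃β₃}`" (`μᵢ ≥ 0`, `r ≥ 1`).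
CLAIM. [cite: Zhang2022LandauSiegel, App. A p.102, tex L5034] -/
def StepA_u011_eq : Prop :=
  ∀ (D : ℕ) (q r : ℕ), q.Prime → 1 ≤ r →
    kappaZ c' D (q ^ r) =
      (∑ μ ∈ Finset.Nat.antidiagonalTuple 3 r,
          (q : ℂ) ^ ((μ 0 : ℂ) * beta1 c' D + (μ 1 : ℂ) * beta2 c' D + (μ 2 : ℂ) * beta3 c' D)) -
        (∑ μ ∈ Finset.Nat.antidiagonalTuple 3 (r - 1),
          (q : ℂ) ^ ((μ 0 : ℂ) * beta1 c' D + (μ 1 : ℂ) * beta2 c' D + (μ 2 : ℂ) * beta3 c' D))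

/-- **Z22:§A.u011, estimate**: "`κ(q^r) = τ₂(q^r)(1 + O(αr log q))`" (`τ₂(q^r) = r + 1`; all primes
`q`, `r ≥ 1`, implied constant absolute). CLAIM. [cite: Zhang2022LandauSiegel, App. A p.102, tex L5034] -/
def StepA_u011 : Prop :=
  ∃ C : ℝ, ForAllLarge fun D _ χ => AssumptionA D χ → ∀ q r : ℕ, q.Prime → 1 ≤ r →
    ‖kappaZ c' D (q ^ r) - ((q ^ r).divisors.card : ℂ)‖ ≤
      C * (alpha D * r * Real.log q) * (q ^ r).divisors.card

/-- **Z22:§A.u012** AS PRINTED (flag F5), Case 1: "`ξ_j(q^r,dh) = Σ_{η≥0}(r+η+1)u^η − r/(1−u)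
+ O(αr log q/q) = 1/(1−u)² + O(αr log q/q)`" — the final form. CLAIM.
[cite: Zhang2022LandauSiegel, App. A p.102, tex L5038] -/
def StepA_u012 : Prop :=
  ∃ C : ℝ, ForAllLarge fun D _ χ => AssumptionA D χ → ∀ j ∈ ({1, 2, 3} : Finset ℕ), ∀ d h : ℕ,
    1 ≤ d → 1 ≤ h → ((d * h : ℕ) : ℝ) < bigP D / bigT D ^ 2 → ∀ q r : ℕ, q.Prime → q < D →
      Nat.Coprime q D → Nat.Coprime q (d * h) → 1 ≤ r →
        ‖xiA c' D j (q ^ r) d h - 1 / (1 - uA q) ^ 2‖ ≤ C * (alpha D * r * Real.log q / q)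

/-- **Z22:§A.u012, middle form** AS PRINTED: "`ξ_j(q^r,dh) = Σ_{η=0}^∞ (r+η+1)u^η − r/(1−u)
+ O(αr log q/q)`". CLAIM. [cite: Zhang2022LandauSiegel, App. A p.102, tex L5038] -/
def StepA_u012_mid : Prop :=
  ∃ C : ℝ, ForAllLarge fun D _ χ => AssumptionA D χ → ∀ j ∈ ({1, 2, 3} : Finset ℕ), ∀ d h : ℕ,
    1 ≤ d → 1 ≤ h → ((d * h : ℕ) : ℝ) < bigP D / bigT D ^ 2 → ∀ q r : ℕ, q.Prime → q < D →
      Nat.Coprime q D → Nat.Coprime q (d * h) → 1 ≤ r →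
        ‖xiA c' D j (q ^ r) d h -
            ((∑' η : ℕ, ((r + η + 1 : ℕ) : ℂ) * uA q ^ η) - (r : ℂ) / (1 - uA q))‖
          ≤ C * (alpha D * r * Real.log q / q)

/-- **Z22:§A.u013** (Case 1): "`Σ_r χ(q^r)ξ_j(q^r;d,h)/q^{rs} = (1/(1−u)²)(1/(1−vu) − 1) + O(α log q/q)`"
under u009. CLAIM. [cite: Zhang2022LandauSiegel, App. A p.102, tex L5042] -/
def StepA_u013 : Prop :=
  ∃ C : ℝ, ForAllLarge fun D _ χ => AssumptionA D χ → ∀ j ∈ ({1, 2, 3} : Finset ℕ), ∀ d h : ℕ,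
    1 ≤ d → 1 ≤ h → ((d * h : ℕ) : ℝ) < bigP D / bigT D ^ 2 → ∀ q : ℕ, q.Prime → ∀ s : ℂ,
      CondA9 D s q → Nat.Coprime q (d * h) →
        ‖xiPowSum c' χ j d h s q - 1 / (1 - uA q) ^ 2 * (1 / (1 - vA χ q * uA q) - 1)‖
          ≤ C * (alpha D * Real.log q / q)

/-- **Z22:§A.u014** (Case 1): "`λ̃(q,dh;1−β_j) = (1−u)² + O(α log q/q)`" (`q < D`, `(q,D) = 1`).
CLAIM. [cite: Zhang2022LandauSiegel, App. A p.102, tex L5047] -/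
def StepA_u014 : Prop :=
  ∃ C : ℝ, ForAllLarge fun D _ χ => AssumptionA D χ → ∀ j ∈ ({1, 2, 3} : Finset ℕ), ∀ d h : ℕ,
    1 ≤ d → 1 ≤ h → ((d * h : ℕ) : ℝ) < bigP D / bigT D ^ 2 → ∀ q : ℕ, q.Prime → q < D →
      Nat.Coprime q D → Nat.Coprime q (d * h) →
        ‖lamTilde c' D q (d * h) (1 - betaJ c' D j) - (1 - uA q) ^ 2‖ ≤ C * (alpha D * Real.log q / q)

/-- **Z22:§A.u015** (printed inside Case 1, used in all three cases): "`(1−χ(q)q^{−s−β_{j+1}})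
(1−χ(q)q^{−s−β_{j+2}})/(1−χ(q)q^{−s}) = 1 − vu + O(α log q/q)`" under u009. CLAIM.
[cite: Zhang2022LandauSiegel, App. A p.102, tex L5051] -/
def StepA_u015 : Prop :=
  ∃ C : ℝ, ForAllLarge fun D _ χ => AssumptionA D χ → ∀ j ∈ ({1, 2, 3} : Finset ℕ), ∀ q : ℕ,
    q.Prime → ∀ s : ℂ, CondA9 D s q →
      ‖pref c' χ j s q - (1 - vA χ q * uA q)‖ ≤ C * (alpha D * Real.log q / q)

/-- "This together with [u014] and [u015] **yields (A.1)**" (tex L5053): Case 1's deduction. CLAIM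
(proof). [cite: Zhang2022LandauSiegel, App. A p.102, tex L5042–5053] -/
def DedA1 : Prop := StepA_u013 c' → StepA_u014 c' → StepA_u015 c' → EqA_1 c'

/-! ### Case 2: `q ∣ h` (u016–u017) -/

/-- **Z22:§A.u016, identity** (Case 2, `q ∣ h`): "`ξ_j(q^r,dh) = κ(q^r)`" (`r ≥ 1`; exact). CLAIM.
[cite: Zhang2022LandauSiegel, App. A p.102, tex L5062] -/
def StepA_u016_eq : Prop :=
  ∀ (D : ℕ) (j d h q r : ℕ), 1 ≤ d → 1 ≤ h → q.Prime → q ∣ h → 1 ≤ r →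
    xiA c' D j (q ^ r) d h = kappaZ c' D (q ^ r)

/-- **Z22:§A.u016, estimate** AS PRINTED (flag F5): "`ξ_j(q^r,dh) = r + 1 + O(αr log q/q)`"
(Case 2, under u009). CLAIM. [cite: Zhang2022LandauSiegel, App. A p.102, tex L5062] -/
def StepA_u016 : Prop :=
  ∃ C : ℝ, ForAllLarge fun D _ χ => AssumptionA D χ → ∀ j ∈ ({1, 2, 3} : Finset ℕ), ∀ d h : ℕ,
    1 ≤ d → 1 ≤ h → ((d * h : ℕ) : ℝ) < bigP D / bigT D ^ 2 → ∀ q r : ℕ, q.Prime → q < D →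
      Nat.Coprime q D → q ∣ h → 1 ≤ r →
        ‖xiA c' D j (q ^ r) d h - ((r : ℂ) + 1)‖ ≤ C * (alpha D * r * Real.log q / q)

/-- **Z22:§A.u017** (Case 2): "`Σ_r χ(q^r)ξ_j(q^r;d,h)/q^{rs} = 1/(1−vu)² − 1 + O(α log q/q)`"
under u009. CLAIM. [cite: Zhang2022LandauSiegel, App. A p.103, tex L5066] -/
def StepA_u017 : Prop :=
  ∃ C : ℝ, ForAllLarge fun D _ χ => AssumptionA D χ → ∀ j ∈ ({1, 2, 3} : Finset ℕ), ∀ d h : ℕ,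
    1 ≤ d → 1 ≤ h → ((d * h : ℕ) : ℝ) < bigP D / bigT D ^ 2 → ∀ q : ℕ, q.Prime → ∀ s : ℂ,
      CondA9 D s q → q ∣ h →
        ‖xiPowSum c' χ j d h s q - (1 / (1 - vA χ q * uA q) ^ 2 - 1)‖
          ≤ C * (alpha D * Real.log q / q)

/-- **Z22:§A.u017 (text, tex L5068)**: "since `λ̃(q,dh;1−β_j) = 1`" when `q ∣ h` (empty product).
CLAIM. [cite: Zhang2022LandauSiegel, App. A p.103, tex L5068] -/
def StepA_u017_lamTilde : Prop :=
  ∀ (D : ℕ) (j d h q : ℕ), 1 ≤ d → q.Prime → q ∣ h → lamTilde c' D q (d * h) (1 - betaJ c' D j) = 1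

/-- "This **yields (A.2)** since `λ̃(q,dh;1−β_j) = 1`" (tex L5068): Case 2's deduction (with the
first factor from u015). CLAIM (proof). [cite: Zhang2022LandauSiegel, App. A p.103, tex L5066–5068] -/
def DedA2 : Prop := StepA_u017 c' → StepA_u017_lamTilde c' → StepA_u015 c' → EqA_2 c'

/-! ### Case 3: `q ∣ d`, `(q,h₁) = 1` [read `(q,h) = 1`] (u018–u019) -/

/-- **Z22:§A.u018 (text, tex L5076)**: "We also have `λ̃(q,dh;1−β_j) = 1`" when `q ∣ d`. CLAIM.
[cite: Zhang2022LandauSiegel, App. A p.103, tex L5076] -/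
def StepA_u018_lamTilde : Prop :=
  ∀ (D : ℕ) (j d h q : ℕ), 1 ≤ h → q.Prime → q ∣ d → lamTilde c' D q (d * h) (1 - betaJ c' D j) = 1

/-- **Z22:§A.u018, identity** AS PRINTED (flag F6: `q/(q−1)`, where u010's pattern gives
`q^{1−β_j}/(q−1)`), Case 3: "`ξ_j(q^r,dh) = κ(q^r) − κ(q^{r−1})q/(q−1)`" (`r ≥ 1`). CLAIM.
[cite: Zhang2022LandauSiegel, App. A p.103, tex L5077] -/
def StepA_u018_eq : Prop :=
  ∀ (D : ℕ) (j d h q r : ℕ), 1 ≤ d → 1 ≤ h → q.Prime → q ∣ d → Nat.Coprime q h → 1 ≤ r →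
    xiA c' D j (q ^ r) d h = kappaZ c' D (q ^ r) - kappaZ c' D (q ^ (r - 1)) * (q : ℂ) / ((q : ℂ) - 1)

/-- **Z22:§A.u018, estimate** AS PRINTED (flag F5), Case 3: "`ξ_j(q^r,dh) = r + 1 − r/(1−u)
+ O(αr log q/q)`" under u009. CLAIM. [cite: Zhang2022LandauSiegel, App. A p.103, tex L5077] -/
def StepA_u018 : Prop :=
  ∃ C : ℝ, ForAllLarge fun D _ χ => AssumptionA D χ → ∀ j ∈ ({1, 2, 3} : Finset ℕ), ∀ d h : ℕ,
    1 ≤ d → 1 ≤ h → ((d * h : ℕ) : ℝ) < bigP D / bigT D ^ 2 → ∀ q r : ℕ, q.Prime → q < D →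
      Nat.Coprime q D → q ∣ d → Nat.Coprime q h → 1 ≤ r →
        ‖xiA c' D j (q ^ r) d h - ((r : ℂ) + 1 - (r : ℂ) / (1 - uA q))‖
          ≤ C * (alpha D * r * Real.log q / q)

/-- **Z22:§A.u019** (Case 3): "`Σ_r χ(q^r)ξ_j(q^r;d,h)/q^{rs} = 1/(1−vu)² − 1 − vu/((1−u)(1−vu)²)
+ O(α log q/q)`" under u009. CLAIM. [cite: Zhang2022LandauSiegel, App. A p.103, tex L5081] -/
def StepA_u019 : Prop :=
  ∃ C : ℝ, ForAllLarge fun D _ χ => AssumptionA D χ → ∀ j ∈ ({1, 2, 3} : Finset ℕ), ∀ d h : ℕ,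
    1 ≤ d → 1 ≤ h → ((d * h : ℕ) : ℝ) < bigP D / bigT D ^ 2 → ∀ q : ℕ, q.Prime → ∀ s : ℂ,
      CondA9 D s q → q ∣ d → Nat.Coprime q h →
        ‖xiPowSum c' χ j d h s q -
            (1 / (1 - vA χ q * uA q) ^ 2 - 1 -
              vA χ q * uA q / ((1 - uA q) * (1 - vA χ q * uA q) ^ 2))‖
          ≤ C * (alpha D * Real.log q / q)

/-- "This **yields (A.3)**" (tex L5083): Case 3's deduction (first factor from u015). CLAIM (proof).
[cite: Zhang2022LandauSiegel, App. A p.103, tex L5081–5083] -/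
def DedA3 : Prop := StepA_u019 c' → StepA_u018_lamTilde c' → StepA_u015 c' → EqA_3 c'

/-- **Z22:Lem8.3.pf** — the manuscript's deduction of Lemma 8.3 (§8 node `Skeleton.Lemma83 c′`, a
leaf of `Skeleton.theorem1_of_leaves`) from the displayed steps of Appendix A pp. 101–103: "the
proof is reduced to showing (A.1)–(A.3)" given u002, u004, u006 (in the instance used), the text of
L4999 (local estimate, analyticity), u007, u008 and `𝔱_j = 1` for `q ∣ D`. Inputs u004/u007/u008 AS
PRINTED (flag F2; the prefactor-free chain is `DedLem83_read`). CLAIM (proof).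
[cite: Zhang2022LandauSiegel, App. A pp.101–103, tex L4975–5083] -/
def DedLem83 : Prop :=
  StepA_u002 c' → StepA_u004 c' → StepA_u006_used c' → StepA_u007_local c' →
    StepA_u007_analytic c' → StepA_u007 c' → StepA_u008 c' → StepA_u008_dvd c' →
      EqA_1 c' → EqA_2 c' → EqA_3 c' → Skeleton.Lemma83 c'

/-- Z22:Lem8.3.pf along the PREFACTOR-FREE READING (flag F2; NOT the printed chain): Lemma 8.3 from
`StepA_u004_read`, the local estimate and analyticity (text of L4999), `StepA_u007_read`, `𝔱_j = 1`
for `q ∣ D`, and (A.1)–(A.3). CLAIM (proof, reading). [cite: Zhang2022LandauSiegel, App. A pp.101–103, tex L4975–5083] -/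
def DedLem83_read : Prop :=
  StepA_u004_read c' → StepA_u006_used c' → StepA_u007_local c' → StepA_u007_analytic c' →
    StepA_u007_read c' → StepA_u008_dvd c' → EqA_1 c' → EqA_2 c' → EqA_3 c' → Skeleton.Lemma83 c'

/-! ## (A.4), (A.5): prerequisites for Lemmas 15.2–15.3 ("assume `dl < P₂²`, `(dl,D) = 1`,
`|s−1| < 5α`") -/

/-- **(A.4)** (Z22:(A.4)): for `dl < P₂²`, `(dl,D) = 1`, `|s−1| < 5α`: "`𝔪₁(d,l;s) = ∏_{q<D}
[(1−q^{−s−β₁})(1−q^{−s−β₂})/((1−q^{−s})(1−χ(q)q^{−s}))](1 + λ̃₁(q,d)Σ_r ξ₁(q^r;d,l)/q^{rs}) ×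
(1 + O(D^{−c}))`" — `𝔪₁` = its analytic continuation `M` to `σ > 9/10` (§15 p.84); relative error.
CLAIM. [cite: Zhang2022LandauSiegel, App. A (A.4) p.103, tex L5099] -/
def EqA_4 : Prop :=
  ∃ c : ℝ, 0 < c ∧ ∃ C : ℝ, ForAllLarge fun D _ χ => AssumptionA D χ → ∀ d l : ℕ, 1 ≤ d → 1 ≤ l →
    ((d * l : ℕ) : ℝ) < Skeleton.P2 D ^ 2 → Nat.Coprime (d * l) D → ∀ M : ℂ → ℂ,
      DifferentiableOn ℂ M {s : ℂ | 9 / 10 < s.re} → (∀ s : ℂ, 1 < s.re → M s = frakm1 c' χ d l s) →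
        ∀ s : ℂ, ‖s - 1‖ < 5 * alpha D →
          ‖M s - (∏ q ∈ Nat.primesBelow D, factorA4 c' χ d l s q)‖ ≤
            C * (D : ℝ) ^ (-c) * ‖(∏ q ∈ Nat.primesBelow D, factorA4 c' χ d l s q)‖

/-- **Z22:§A.u020**: "Note that `κ̃₁(q^{r−1},dq) = κ₁(q^{r−1})`" (`κ̃₁(·;·) = κ̃₁(·;·,1)`; any `q`
prime, `d`, exponent). CLAIM. [cite: Zhang2022LandauSiegel, App. A p.103, tex L5105] -/
def StepA_u020 : Prop :=
  ∀ (D : ℕ) [NeZero D] (χ : DirichletCharacter ℂ D), ∀ d q r : ℕ, 1 ≤ d → q.Prime →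
    kappaTilde1 c' χ (q ^ r) (d * q) 1 = kappa1 c' D (q ^ r)

/-- **(A.5)** (Z22:(A.5)): "`ξ₁(q^r;d,l) = κ̃₁(q^r,d) − (χ(q)q/(q−1))κ₁(q^{r−1})` if `(q,l) = 1`;
`= κ̃₁(q^r,d)` if `q ∣ l`; for any `q`, `d`, `l` and `r`" (`q` prime, `r ≥ 1`). CLAIM.
[cite: Zhang2022LandauSiegel, App. A (A.5) p.103, tex L5109] -/
def EqA_5 : Prop :=
  ∀ (D : ℕ) [NeZero D] (χ : DirichletCharacter ℂ D), ∀ q d l r : ℕ, q.Prime → 1 ≤ d → 1 ≤ l →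
    1 ≤ r →
      (Nat.Coprime q l → xiOne c' χ (q ^ r) d l =
        kappaTilde1 c' χ (q ^ r) d 1 -
          χ (q : ZMod D) * (q : ℂ) / ((q : ℂ) - 1) * kappa1 c' D (q ^ (r - 1))) ∧
      (q ∣ l → xiOne c' χ (q ^ r) d l = kappaTilde1 c' χ (q ^ r) d 1)

end Claims

/-! ## Merge bridges: the TODO-merge stubs ARE the landed §15 objects (revision 2)

`TypedSection15A` (L4-t1, p412355) and `TypedSection15B` (L4-t2, p412274) have landed; the six
stubs above are definitionally their decls (L4 NAMING v1: `kappa1`, `kappaTilde1`, `lam1` in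
`Typed.Section15A`; `xi1`, `lamTilde1`, `calM1Series`, `calM1Factor` in `Typed.Section15B`), so the
nodes (A.4), u020, (A.5) above read verbatim over the providers' objects. Nothing is restated; the
bridges are `rfl` except the `q`-factor of (A.4), whose `r ≥ 1` series is indexed by `r + 1` here
and by `if r = 0 then 0 else …` in `Typed.Section15B.xi1LocalSeries`. -/

section Merge

variable (c' : ℝ) {D : ℕ} (χ : DirichletCharacter ℂ D)

/-- Stub `kappa1` = `Typed.Section15A.kappa1` (both the tree's `MeanSquareMajorant.kappa₁ b₁ b₂`).
[cite: Zhang2022LandauSiegel, §15 p.81, tex L4078] -/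
theorem kappa1_eq (D : ℕ) : kappa1 c' D = Typed.Section15A.kappa1 c' D := rfl

/-- Stub `kappaTilde1` = `Typed.Section15A.kappaTilde1` ((15.9)). [cite: Zhang2022LandauSiegel, §15 (15.9) p.82] -/
theorem kappaTilde1_eq (d r : ℕ) (s : ℂ) :
    kappaTilde1 c' χ d r s = Typed.Section15A.kappaTilde1 c' χ d r s := rfl

/-- Stub `lam1` = `Typed.Section15A.lam1` ((15.10)). [cite: Zhang2022LandauSiegel, §15 (15.10) p.82] -/
theorem lam1_eq (n : ℕ) (s : ℂ) : lam1 c' χ n s = Typed.Section15A.lam1 c' χ n s := rfl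

/-- Stub `xiOne` = `Typed.Section15B.xi1` ((15.13); NAMING v1 name `xi1`).
[cite: Zhang2022LandauSiegel, §15 (15.13) p.83] -/
theorem xiOne_eq (n d l : ℕ) : xiOne c' χ n d l = Typed.Section15B.xi1 c' χ n d l := rfl

/-- Stub `lamTilde1` = `Typed.Section15B.lamTilde1` (§15 p.83). [cite: Zhang2022LandauSiegel, §15 p.83, tex L4176] -/
theorem lamTilde1_eq (n d : ℕ) : lamTilde1 c' χ n d = Typed.Section15B.lamTilde1 c' χ n d := rfl

/-- Stub `frakm1` = `Typed.Section15B.calM1Series` (the printed `σ > 1` expression of `𝓜₁(d,l;s)`, §15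
p.84; NAMING v1 name `calM1Series`). [cite: Zhang2022LandauSiegel, §15 p.84, tex L4225] -/
theorem frakm1_eq [NeZero D] (d l : ℕ) (s : ℂ) :
    frakm1 c' χ d l s = Typed.Section15B.calM1Series c' χ d l s := rfl

omit χ in
/-- Re-indexing an `r ≥ 1` series: `Σ' r, [r ≠ 0]·g(r) = Σ' r, g(r+1)` (both sides are the junk value
`0` when `g ∘ succ` is not summable). [folklore] -/
private theorem tsum_ite_zero_eq_tsum_succ (g : ℕ → ℂ) :
    (∑' r : ℕ, if r = 0 then (0 : ℂ) else g r) = ∑' r : ℕ, g (r + 1) := by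
  set F : ℕ → ℂ := fun r => if r = 0 then 0 else g r with hF
  have hF1 : (fun r => F (r + 1)) = fun r => g (r + 1) := by
    funext r
    simp [hF]
  by_cases h : Summable (fun r => g (r + 1))
  · have h' : Summable (fun r => F (r + 1)) := by rw [hF1]; exact h
    rw [(tsum_eq_zero_add' h').trans (by rw [hF1])]
    simp [hF]
  · have h' : ¬ Summable F := by
      intro hS
      exact h (by rw [← hF1]; exact (summable_nat_add_iff 1).mpr hS)
    rw [tsum_eq_zero_of_not_summable h', tsum_eq_zero_of_not_summable h]

/-- The `q`-factor of (A.4) is `Typed.Section15B.calM1Factor` (the Euler factor of `𝓜₁` on §15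
p.84, tex L4199), argument order `(d l s q) ↔ (q d l s)`. [cite: Zhang2022LandauSiegel, App. A (A.4) p.103; §15 p.84] -/
theorem factorA4_eq (d l : ℕ) (s : ℂ) (q : ℕ) :
    factorA4 c' χ d l s q = Typed.Section15B.calM1Factor c' χ q d l s := by
  have h1 : Typed.Section15B.xi1LocalSeries c' χ q d l s =
      ∑' r : ℕ, xiOne c' χ (q ^ (r + 1)) d l / (q : ℂ) ^ (((r + 1 : ℕ) : ℂ) * s) := by
    unfold Typed.Section15B.xi1LocalSeries
    exact tsum_ite_zero_eq_tsum_succ _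
  unfold factorA4 Typed.Section15B.calM1Factor
  rw [h1]
  rfl

end Merge

end Literature.NumberTheory.LFunctions.Zhang2022.Typed.AppendixA1
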